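import Summits.KontsevichZagierPeriods.KontsevichZagierPeriods.Theses.ComplexOrientations
import Summits.KontsevichZagierPeriods.KontsevichZagierPeriods.Theorems.HermiteRigidityGenusTwoCycleTransferPushforwardDimOne
import Literature.NumberTheory.Transcendental.KZCalculusProofs
import Literature.NumberTheory.Transcendental.KZSemiCanonicalReductionProofs

/-!
# Crux `OrientationKernel` (stmt-KontsevichZagierPeriods-11367), line `birth`: same-dimension tools of
the Kontsevich–Zagier calculus in dimension one

Support file for the necessity theorem `OrientationKernel → AbelContraction.ReductionToDimensionOne`
(file `ComplexOrientationsOrientationKernelReductionNecessity.lean`). The calculus of moves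
(`Literature.NumberTheory.Transcendental.KZ`) merges two representations only one dimension UP
(`KZ.IntegralRep.exists_of_add_of_sub_of_mem_relations`: slabs at disjoint levels). To read the
hypothesis of `ReductionToDimensionOne` — "`R` contains `[r] − [r']` for all equal-valued
ONE-dimensional `r, r'`" — on an arbitrary `ℤ`-combination of one-dimensional classes one needs a
merge INSIDE dimension one, for representations whose domains may be unbounded (e.g. the Cauchy
relators of route ComplexOrientations live on `ℝ = Set.univ`). This file supplies it:

* `exists_split_zero` — rule (1a): `[σ, f] ≡ [σ ∩ {t ≥ 0}, f] + [σ ∩ {t < 0}, f]`;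
* `exists_chart` — rule (2) along the rational chart `t ↦ t / (1 + ε t)` (`ε = ±1`, on the half-line
  `ε t ≥ 0`), an instance of the landed one-dimensional push-forward
  `HermiteRigidity.GenusTwoCycleTransfer.stub_pushforwardDimOne` (inverse chart `u ↦ u / (1 − ε u)`);
* `exists_isBounded_sub_mem_relations_one` — **bounded normal form in dimension one**: every
  `r : IntegralRep 1` is congruent modulo `KZ.relations` to ONE representation with domain inside
  `(−1, 1)` (split at `0`, push the two halves into `[0, 1)` and `(−1, 0)`, glue by rule (1a));
* `exists_add_sub_mem_relations_one` — **merging in dimension one**: `[a] + [b] ≡ [c]` (bounded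
  normal forms, translate the second by `2` — rule (2), `KZ.exists_translate` — and glue);
* `exists_pair_of_mem_closure_one` — every element of the subgroup generated by the one-dimensional
  classes is `≡ [a] − [b]` with `a, b` one-dimensional (`AddSubgroup.closure_induction`).

Only proved tree API is used (rules (1a), (2) and their packaged forms); no definitions, no named
facts, no transcendence input.

References: M. Kontsevich, D. Zagier, *Periods* (2001), §1.2, rules (1), (2); J. Viu-Sos,
*A semi-canonical reduction for periods of Kontsevich–Zagier*, Int. J. Number Theory 17 (2021),
Thm. 2.1 (compactification of the domain by charts of the projective line).
-/

noncomputable section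

open Set MeasureTheory
open Literature.NumberTheory.Transcendental Literature.ModelTheory.ExponentialFields
open Summit.KontsevichZagierPeriods.HermiteRigidity.GenusTwoCycleTransfer (stub_pushforwardDimOne)

namespace Summit.KontsevichZagierPeriods.ComplexOrientations.OrientationKernel

/-- **Splitting a one-dimensional representation at the origin** (rule (1a)): `[σ, f]` minus its
restrictions to `σ ∩ {t ≥ 0}` and `σ ∩ {t < 0}` is a single domain-additivity move (the two pieces
are disjoint). [Kontsevich–Zagier 2001, §1.2, rule (1)] -/
theorem exists_split_zero (r : KZ.IntegralRep 1) :
    ∃ r₁ r₂ : KZ.IntegralRep 1, r₁.domain = r.domain ∩ {p | 0 ≤ p 0} ∧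
      r₂.domain = r.domain ∩ {p | p 0 < 0} ∧ r₁.integrand = r.integrand ∧
      r₂.integrand = r.integrand ∧ KZ.of r - KZ.of r₁ - KZ.of r₂ ∈ KZ.domainAddRel := by
  have h1 : IsSemialgebraic ℚ {p : Fin 1 → ℝ | 0 ≤ p 0} := by
    simpa using isSemialgebraic_setOf_eval_nonneg (k := ℚ) (R := ℝ) (MvPolynomial.X (0 : Fin 1))
  have h2 : IsSemialgebraic ℚ {p : Fin 1 → ℝ | p 0 < 0} := by
    simpa using isSemialgebraic_setOf_eval_lt (k := ℚ) (R := ℝ) (MvPolynomial.X (0 : Fin 1)) 0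
  set r₁ : KZ.IntegralRep 1 :=
    r.restrict _ (r.isSemialgebraic_domain.inter h1) inter_subset_left with hr₁
  set r₂ : KZ.IntegralRep 1 :=
    r.restrict _ (r.isSemialgebraic_domain.inter h2) inter_subset_left with hr₂
  refine ⟨r₁, r₂, rfl, rfl, rfl, rfl, ?_⟩
  refine ⟨1, r, r₁, r₂, ?_, ?_, fun _ _ => rfl, fun _ _ => rfl, rfl⟩
  · show r.domain = (r.domain ∩ {p | 0 ≤ p 0}) ∪ (r.domain ∩ {p | p 0 < 0})
    ext p
    simp only [mem_union, mem_inter_iff, mem_setOf_eq]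
    constructor
    · intro hp
      rcases le_or_gt 0 (p 0) with h | h
      · exact Or.inl ⟨hp, h⟩
      · exact Or.inr ⟨hp, h⟩
    · rintro (⟨hp, -⟩ | ⟨hp, -⟩) <;> exact hp
  · show volume ((r.domain ∩ {p : Fin 1 → ℝ | 0 ≤ p 0}) ∩ (r.domain ∩ {p : Fin 1 → ℝ | p 0 < 0})) = 0
    have : (r.domain ∩ {p : Fin 1 → ℝ | 0 ≤ p 0}) ∩ (r.domain ∩ {p : Fin 1 → ℝ | p 0 < 0}) = ∅ := by
      ext p
      simp only [mem_inter_iff, mem_setOf_eq, mem_empty_iff_false, iff_false, not_and, not_lt]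
      intro h _
      exact h.2
    rw [this, measure_empty]

/-- **The rational chart of a half-line** (rule (2)). For a rational `ε` (used with `ε = ±1`) and a
one-dimensional representation `r` whose domain lies in `{t | ε t ≥ 0}`, there is a representation
`s` with domain the image of `r.domain` under `t ↦ t / (1 + ε t)` such that `[r] − [s]` is a single
change-of-variables move — the one-dimensional push-forward `stub_pushforwardDimOne` along
`φ(t) = t / (1 + ε t)` (derivative `1 / (1 + ε t)² ≠ 0`, inverse chart `u ↦ u / (1 − ε u)`, all
rational over `ℚ`). [Kontsevich–Zagier 2001, §1.2, rule (2); Viu-Sos 2021, Thm. 2.1] -/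
theorem exists_chart (r : KZ.IntegralRep 1) (ε : ℚ) (hr : ∀ p ∈ r.domain, 0 ≤ (ε : ℝ) * p 0) :
    ∃ s : KZ.IntegralRep 1,
      s.domain = (fun p : Fin 1 → ℝ => fun _ : Fin 1 => p 0 / (1 + (ε : ℝ) * p 0)) '' r.domain ∧
      KZ.of r - KZ.of s ∈ KZ.changeOfVariablesRel := by
  have hσ : IsSemialgebraic ℚ r.domain := r.isSemialgebraic_domain
  have hpos : ∀ p ∈ r.domain, 0 < 1 + (ε : ℝ) * p 0 := fun p hp => by
    have := hr p hp
    linarith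
  -- the chart, its derivative and its inverse
  set φ : ℝ → ℝ := fun t => t / (1 + (ε : ℝ) * t) with hφ_def
  set φ' : ℝ → ℝ := fun t => 1 / (1 + (ε : ℝ) * t) ^ 2 with hφ'_def
  set G : (Fin 1 → ℝ) → (Fin 1 → ℝ) := fun q _ => q 0 / (1 - (ε : ℝ) * q 0) with hG_def
  -- semialgebraicity of `φ` and `φ'` on the domain (quotients of polynomials over `ℚ`)
  have hφ : IsSemialgebraicFunOn ℚ r.domain (fun p => φ (p 0)) := by
    refine (isSemialgebraicFunOn_aeval_div_aeval hσ (MvPolynomial.X 0)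
      (1 + MvPolynomial.C ε * MvPolynomial.X 0) fun p hp => ?_).congr fun p _ => ?_
    · simp only [map_add, map_one, map_mul, MvPolynomial.aeval_C, MvPolynomial.aeval_X, eq_ratCast]
      exact (hpos p hp).ne'
    · simp only [map_add, map_one, map_mul, MvPolynomial.aeval_C, MvPolynomial.aeval_X, eq_ratCast,
        hφ_def]
  have hφ' : IsSemialgebraicFunOn ℚ r.domain (fun p => φ' (p 0)) := by
    refine (isSemialgebraicFunOn_aeval_div_aeval hσ (1 : MvPolynomial (Fin 1) ℚ)
      ((1 + MvPolynomial.C ε * MvPolynomial.X 0) ^ 2) fun p hp => ?_).congr fun p _ => ?_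
    · simp only [map_pow, map_add, map_one, map_mul, MvPolynomial.aeval_C, MvPolynomial.aeval_X,
        eq_ratCast]
      exact pow_ne_zero 2 (hpos p hp).ne'
    · simp only [map_pow, map_add, map_one, map_mul, MvPolynomial.aeval_C, MvPolynomial.aeval_X,
        eq_ratCast, hφ'_def]
  -- the derivative
  have hder : ∀ p ∈ r.domain, HasDerivAt φ (φ' (p 0)) (p 0) := fun p hp => by
    have h1 : HasDerivAt (fun y : ℝ => 1 + (ε : ℝ) * y) (ε : ℝ) (p 0) := by
      simpa using ((hasDerivAt_id (p 0)).const_mul (ε : ℝ)).const_add 1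
    have h2 : HasDerivAt (fun y : ℝ => y / (1 + (ε : ℝ) * y))
        ((1 * (1 + (ε : ℝ) * p 0) - p 0 * (ε : ℝ)) / (1 + (ε : ℝ) * p 0) ^ 2) (p 0) :=
      (hasDerivAt_id' (p 0)).div h1 (hpos p hp).ne'
    refine h2.congr_deriv ?_
    show _ = (1 : ℝ) / (1 + (ε : ℝ) * p 0) ^ 2
    congr 1
    ring
  have hne : ∀ p ∈ r.domain, φ' (p 0) ≠ 0 := fun p hp =>
    div_ne_zero one_ne_zero (pow_ne_zero 2 (hpos p hp).ne')
  -- the image and the inverse chart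
  set Φ : (Fin 1 → ℝ) → (Fin 1 → ℝ) := fun p _ => φ (p 0) with hΦ_def
  have hΦsa : IsSemialgebraicMapOn ℚ r.domain Φ := IsSemialgebraicMapOn.of_forall hσ fun _ => hφ
  have hT : IsSemialgebraic ℚ (Φ '' r.domain) :=
    IsSemialgebraicMapOn.isSemialgebraic_image_holds hΦsa subset_rfl hσ
  have hkey : ∀ p ∈ r.domain, (1 : ℝ) - (ε : ℝ) * (p 0 / (1 + (ε : ℝ) * p 0)) = 1 / (1 + (ε : ℝ) * p 0) :=
    fun p hp => by
    have hD := (hpos p hp).ne'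
    field_simp
    ring
  have hden : ∀ q ∈ Φ '' r.domain, 1 - (ε : ℝ) * q 0 ≠ 0 := by
    rintro _ ⟨p, hp, rfl⟩
    show (1 : ℝ) - (ε : ℝ) * (p 0 / (1 + (ε : ℝ) * p 0)) ≠ 0
    rw [hkey p hp]
    exact div_ne_zero one_ne_zero (hpos p hp).ne'
  have hG : IsSemialgebraicMapOn ℚ (Φ '' r.domain) G := by
    refine IsSemialgebraicMapOn.of_forall hT fun _ => ?_
    refine (isSemialgebraicFunOn_aeval_div_aeval hT (MvPolynomial.X 0)
      (1 - MvPolynomial.C ε * MvPolynomial.X 0) fun q hq => ?_).congr fun q _ => ?_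
    · simp only [map_sub, map_one, map_mul, MvPolynomial.aeval_C, MvPolynomial.aeval_X, eq_ratCast]
      exact hden q hq
    · simp only [map_sub, map_one, map_mul, MvPolynomial.aeval_C, MvPolynomial.aeval_X, eq_ratCast,
        hG_def]
  have hGφ : ∀ p ∈ r.domain, G (fun _ => φ (p 0)) = p := fun p hp => by
    have hD := (hpos p hp).ne'
    funext i
    rw [Subsingleton.elim i 0]
    show p 0 / (1 + (ε : ℝ) * p 0) / (1 - (ε : ℝ) * (p 0 / (1 + (ε : ℝ) * p 0))) = p 0
    rw [hkey p hp, div_div_div_cancel_right₀ hD, div_one]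
  obtain ⟨s, hsd, -, hmove⟩ := stub_pushforwardDimOne r φ φ' G hφ hφ' hder hne hG hGφ
  exact ⟨s, hsd, hmove⟩

/-- **Bounded normal form in dimension one.** Every one-dimensional representation `r` is
congruent modulo `KZ.relations` to a representation `s` whose domain lies in the open interval
`(−1, 1)`: split `r` at the origin (rule (1a)), push the non-negative half into `[0, 1)` along
`t ↦ t / (1 + t)` and the negative half into `(−1, 0)` along `t ↦ t / (1 − t)` (rule (2),
`exists_chart`), and glue the two disjoint images (rule (1a)).
[Kontsevich–Zagier 2001, §1.2, rules (1), (2); Viu-Sos 2021, Thm. 2.1] -/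
theorem exists_isBounded_sub_mem_relations_one (r : KZ.IntegralRep 1) :
    ∃ s : KZ.IntegralRep 1, s.domain ⊆ {q | -1 < q 0 ∧ q 0 < 1} ∧
      KZ.of r - KZ.of s ∈ KZ.relations := by
  obtain ⟨r₁, r₂, hd₁, hd₂, -, -, hsplit⟩ := exists_split_zero r
  obtain ⟨s₁, hs₁, hm₁⟩ := exists_chart r₁ 1 fun p hp => by
    rw [hd₁] at hp
    simpa using hp.2
  obtain ⟨s₂, hs₂, hm₂⟩ := exists_chart r₂ (-1) fun p hp => by
    rw [hd₂] at hp
    have : p 0 < 0 := hp.2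
    push_cast
    linarith
  -- location of the two images
  have hloc₁ : ∀ q ∈ s₁.domain, 0 ≤ q 0 ∧ q 0 < 1 := by
    rw [hs₁]
    rintro _ ⟨p, hp, rfl⟩
    rw [hd₁] at hp
    have h0 : 0 ≤ p 0 := hp.2
    push_cast
    refine ⟨by positivity, ?_⟩
    rw [div_lt_one (by linarith)]
    linarith
  have hloc₂ : ∀ q ∈ s₂.domain, -1 < q 0 ∧ q 0 < 0 := by
    rw [hs₂]
    rintro _ ⟨p, hp, rfl⟩
    rw [hd₂] at hp
    have h0 : p 0 < 0 := hp.2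
    push_cast
    have hD : 0 < 1 + (-1 : ℝ) * p 0 := by linarith
    constructor
    · rw [lt_div_iff₀ hD]
      linarith
    · exact div_neg_of_neg_of_pos h0 hD
  have hdisj : Disjoint s₁.domain s₂.domain := Set.disjoint_left.2 fun q h₁ h₂ => by
    have := (hloc₁ q h₁).1
    have := (hloc₂ q h₂).2
    linarith
  refine ⟨s₁.glue s₂ hdisj, ?_, ?_⟩
  · rintro q (hq | hq)
    · have := hloc₁ q hq
      exact ⟨by linarith [this.1], this.2⟩
    · have := hloc₂ q hq
      exact ⟨this.1, by linarith [this.2]⟩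
  · have hglue := KZ.domainAddRel_subset_relations
      (KZ.IntegralRep.of_glue_sub_sub_mem_domainAddRel s₁ s₂ hdisj)
    have : KZ.of r - KZ.of (s₁.glue s₂ hdisj) = (KZ.of r - KZ.of r₁ - KZ.of r₂) +
        (KZ.of r₁ - KZ.of s₁) + (KZ.of r₂ - KZ.of s₂) -
        (KZ.of (s₁.glue s₂ hdisj) - KZ.of s₁ - KZ.of s₂) := by
      abel
    rw [this]
    exact KZ.relations.sub_mem (KZ.relations.add_mem (KZ.relations.add_mem
      (KZ.domainAddRel_subset_relations hsplit) (KZ.changeOfVariablesRel_subset_relations hm₁))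
      (KZ.changeOfVariablesRel_subset_relations hm₂)) hglue

/-- **Merging in dimension one.** Any two one-dimensional representations `a`, `b` merge into one
modulo `KZ.relations`: `[a] + [b] − [c] ∈ KZ.relations` for some `c : IntegralRep 1`. Put both in
bounded normal form inside `(−1, 1)` (`exists_isBounded_sub_mem_relations_one`), translate the
second by `2` (rule (2), `KZ.exists_translate`) so that it lives in `(1, 3)`, and glue (rule (1a)).
[Kontsevich–Zagier 2001, §1.2, rules (1), (2)] -/
theorem exists_add_sub_mem_relations_one (a b : KZ.IntegralRep 1) :
    ∃ c : KZ.IntegralRep 1, KZ.of a + KZ.of b - KZ.of c ∈ KZ.relations := by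
  obtain ⟨a', ha', ea⟩ := exists_isBounded_sub_mem_relations_one a
  obtain ⟨b', hb', eb⟩ := exists_isBounded_sub_mem_relations_one b
  obtain ⟨b'', hb''d, -, et⟩ := KZ.exists_translate b' (fun _ => (2 : ℚ))
  have hloc : ∀ q ∈ b''.domain, 1 < q 0 := fun q hq => by
    rw [hb''d] at hq
    have h := (hb' hq).1
    simp only [Pi.sub_apply, Rat.cast_ofNat] at h
    linarith
  have hdisj : Disjoint a'.domain b''.domain := Set.disjoint_left.2 fun q h₁ h₂ => by
    have := (ha' h₁).2
    have := hloc q h₂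
    linarith
  refine ⟨a'.glue b'' hdisj, ?_⟩
  have hglue := KZ.domainAddRel_subset_relations
    (KZ.IntegralRep.of_glue_sub_sub_mem_domainAddRel a' b'' hdisj)
  have : KZ.of a + KZ.of b - KZ.of (a'.glue b'' hdisj) = (KZ.of a - KZ.of a') + (KZ.of b - KZ.of b') +
      (KZ.of b' - KZ.of b'') - (KZ.of (a'.glue b'' hdisj) - KZ.of a' - KZ.of b'') := by
    abel
  rw [this]
  exact KZ.relations.sub_mem (KZ.relations.add_mem (KZ.relations.add_mem ea eb)
    (KZ.changeOfVariablesRel_subset_relations et)) hglue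

/-- **The subgroup generated by the one-dimensional classes consists of pairs.** Every element of
`AddSubgroup.closure {[s] | s : IntegralRep 1}` is congruent modulo `KZ.relations` to a difference
`[a] − [b]` of two one-dimensional classes: `0 ≡ [∅] − [∅]`, `[s] ≡ [s] − [∅]`
(`KZ.IntegralRep.of_empty_mem_relations`), negation swaps, and sums merge by
`exists_add_sub_mem_relations_one`. [Kontsevich–Zagier 2001, §1.2] -/
theorem exists_pair_of_mem_closure_one :
    ∀ c ∈ AddSubgroup.closure (Set.range fun s : KZ.IntegralRep 1 => KZ.of s),
      ∃ a b : KZ.IntegralRep 1, c - (KZ.of a - KZ.of b) ∈ KZ.relations := by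
  intro c hc
  induction hc using AddSubgroup.closure_induction with
  | mem x hx =>
    obtain ⟨s, rfl⟩ := hx
    refine ⟨s, KZ.IntegralRep.empty 1, ?_⟩
    have : KZ.of s - (KZ.of s - KZ.of (KZ.IntegralRep.empty 1)) = KZ.of (KZ.IntegralRep.empty 1) := by
      abel
    rw [this]
    exact KZ.IntegralRep.of_empty_mem_relations
  | zero =>
    refine ⟨KZ.IntegralRep.empty 1, KZ.IntegralRep.empty 1, ?_⟩
    simp
  | add x y _ _ hx hy =>
    obtain ⟨a₁, b₁, e₁⟩ := hx
    obtain ⟨a₂, b₂, e₂⟩ := hy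
    obtain ⟨a, ea⟩ := exists_add_sub_mem_relations_one a₁ a₂
    obtain ⟨b, eb⟩ := exists_add_sub_mem_relations_one b₁ b₂
    refine ⟨a, b, ?_⟩
    have : x + y - (KZ.of a - KZ.of b) = (x - (KZ.of a₁ - KZ.of b₁)) + (y - (KZ.of a₂ - KZ.of b₂)) +
        (KZ.of a₁ + KZ.of a₂ - KZ.of a) - (KZ.of b₁ + KZ.of b₂ - KZ.of b) := by
      abel
    rw [this]
    exact KZ.relations.sub_mem (KZ.relations.add_mem (KZ.relations.add_mem e₁ e₂) ea) eb
  | neg x _ hx =>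
    obtain ⟨a, b, e⟩ := hx
    refine ⟨b, a, ?_⟩
    have : -x - (KZ.of b - KZ.of a) = -(x - (KZ.of a - KZ.of b)) := by abel
    rw [this]
    exact KZ.relations.neg_mem e

end Summit.KontsevichZagierPeriods.ComplexOrientations.OrientationKernel

end
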